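import Summits.ResolutionOfSingularities.ResolutionOfSingularities.Theorems.EquisingularLiftEquisingularLiftNatSpecimenQuarticTcDeltaLocalCharts
import HarnessLib


/-!
# [OURS · L1 W4.5(b) · EL♮(3)] SPECIMEN-Q DOWNSTAIRS, part R1b — the LOCAL TWO-STEP REGULARITY of the quartic
# `H = V(x₀²x₃² + x₁⁴ + x₂⁴) ⊂ ℙ³_k` at a singular point: blow up the point, then the REDUCED exceptional trace ⇒ REGULAR
# (crux `EquisingularLiftNatThree` = stmt-ResolutionOfSingularities-20148, line `sections3`; res-L1-w45b-lead-2 CUT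
# 2026-08-27T08:41:07Z «SPECIMEN-Q DOWNSTAIRS» to res-D-pv-034 AS res-L1-s36-pv-3; helper `--supports … --as helper`, closes nothing)

HONEST FRAMING. OURS (cell `res-hironaka`, chain w45b, slot W4.5(b)); NOT a statement of any manuscript; AI-written, weaker
than expert review. Scheme plumbing over res-L1-w45b-stub-4's ring-level T-ISO-1 layer, in the pattern of res-D-pv-022's R2
`…SpecimenWhitneyCubicCharts.isRegular_of_isBlowup_comap`; chart algebra in `…SpecimenQuarticTcDeltaLocalCharts`.

THE STATEMENT (`isRegular_twoStep`). `k` a field with `2` a unit, `D₀ = k[x,y,z]/(z² + x⁴ + y⁴)` (the affine chart `x₀ = 1` of the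
quartic at its singular point `[1:0:0:0]`; the chart `x₃ = 1` is the same polynomial after `x ↔ z`), `𝔪̄₀ = (x̄, ȳ, z̄)`. For EVERY
blow-up `ρ₁ : B₁ → Spec D₀` along `𝔪̄₀~` (the tree's `IsBlowup`) and EVERY blow-up `ρ₂ : B₂ → B₁` along the ideal sheaf of the REDUCED
closed set `ρ₁⁻¹{𝔪̄₀}` (the exceptional curve with its reduced structure — downstairs this is the trace `Z = e ∩ St(H)` of the (TC)
constructor of the registered stub `stub_elnat_tcDeltaPointResolution`, a LINE), the scheme `B₂` is REGULAR. Through the tree's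
`exists_isBlowup_reducedStrictTransform` (p167331, Stacks 080E) this is the regularity, over the singular chart, of the reduced
strict transform of `H` after the two (TC) blow-ups of the ambient space.

PROOF. Stacks 0804 charts of `ρ₁` at `x̄, ȳ, z̄` (`IsBlowup.exists_chart_of_span_range_eq`); the second centre pulls back to a chart
as `√(x̄ⱼ/1)~` (`comap_vanishingIdeal_exceptional`). On the `z̄`-chart it is the unit ideal (`radical_span_exc_two`), `ρ₂` is an
isomorphism there and the chart ring is regular (`isRegularRing_pointChart₂`). On the `x̄`/`ȳ`-charts the centre is
`ε(ȳ₁, ȳ₂)` (`radical_span_exc_eq_of_equiv`, `exists_pointChartⱼ_equiv_track`) and the charts of `ρ₂` at `ε ȳ₁, ε ȳ₂` are the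
REGULAR line-step rings `isRegularRing_lineChart₀/₁` moved by `blowupAlgebra.congrEquiv`.

References: The Stacks Project, Tags 0804, 052Q, 080E; Görtz–Wedhorn I (13.19), Prop. 13.91, Prop. 13.96 (2); res-L1-w45b-lead-2
TARGET T-ISO-0⁺ (L/res-L1-w45b-lead-2/TARGET-T-ISO-0PLUS.lean, OURS).
-/

set_option linter.dupNamespace false

noncomputable section

open CategoryTheory CategoryTheory.Limits AlgebraicGeometry TopologicalSpace
open MvPolynomial
open Literature.AlgebraicGeometry.Resolution
open AlgebraicGeometry.Scheme.IdealSheafData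
open Summit.ResolutionOfSingularities.ResolutionOfSingularities.Theorems.EquisingularLift

namespace Summit.ResolutionOfSingularities.ResolutionOfSingularities.Cruxes.EquisingularLiftNat.Sections

namespace SpecimenQuarticTcDelta

universe u

variable (k : Type) [Field k]

/-- The two line-step chart rings, transported along a presentation `ε`, are regular (stub-4 `isRegularRing_lineChart₀/₁`,
p510354, + `blowupAlgebra.congrEquiv`). [OURS · T-ISO-1 plumbing] -/
theorem isRegularRing_lineChart_map (h2 : IsUnit (2 : k)) (j : Fin 3) (ε : DL k ≃+* Bch k j) (i : Fin 2) :
    IsRegularRing (blowupAlgebra ((cenL k).map ε.toRingHom)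
      (ε.toRingHom (Ideal.Quotient.mk (Ideal.span {gL k}) (WhitneyCubic.cen k i)))) := by
  have hreg : IsRegularRing (blowupAlgebra (cenL k) (Ideal.Quotient.mk (Ideal.span {gL k}) (WhitneyCubic.cen k i))) := by
    fin_cases i
    · exact SpecimenQuartic.isRegularRing_lineChart₀ k h2
    · exact SpecimenQuartic.isRegularRing_lineChart₁ k h2
  haveI := hreg
  exact IsRegularRing.of_ringEquiv (blowupAlgebra.congrEquiv ε (cenL k) (Ideal.Quotient.mk (Ideal.span {gL k}) (WhitneyCubic.cen k i)))

/-- Bookkeeping: `ε (ȳ₁, ȳ₂) = (ε ȳ₁, ε ȳ₂)` as the span of a `Fin 2`-family. [folklore] -/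
theorem map_cenL_eq_span_range (j : Fin 3) (ε : DL k ≃+* Bch k j) :
    (cenL k).map ε.toRingHom =
      Ideal.span (Set.range fun i : Fin 2 => ε.toRingHom (Ideal.Quotient.mk (Ideal.span {gL k}) (WhitneyCubic.cen k i))) := by
  rw [cenL, Ideal.map_map, Ideal.map_span, ← Set.range_comp]
  rfl

/-! ## The theorem -/

/-- **LOCAL TWO-STEP REGULARITY of the quartic at a singular point.** For every blow-up `ρ₁ : B₁ → Spec k[x,y,z]/(z² + x⁴ + y⁴)` at
the singular point `𝔪̄₀` and every blow-up `ρ₂ : B₂ → B₁` along the ideal sheaf of the REDUCED exceptional set `ρ₁⁻¹{𝔪̄₀}`, the scheme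
`B₂` is regular (`char k ≠ 2`). Inputs: line-step presentations `εⱼ : k[y]/(g) ≅ D₀[𝔪̄₀/x̄ⱼ]` (`j = 0, 1`) carrying `ȳ₁` to the
exceptional generator (stub-4's `nonempty_pointChart₀/₁_equiv`, generator-tracking form). [OURS · L1 W4.5b · SPECIMEN-Q DOWNSTAIRS R1]
[cite: StacksProject, Tag 0804] -/
theorem isRegular_twoStep_of_equiv (h2 : IsUnit (2 : k))
    (ε₀ : DL k ≃+* Bch k 0) (hε₀ : ε₀ (Ideal.Quotient.mk (Ideal.span {gL k}) (X 1)) = exc k 0)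
    (ε₁ : DL k ≃+* Bch k 1) (hε₁ : ε₁ (Ideal.Quotient.mk (Ideal.span {gL k}) (X 1)) = exc k 1)
    {B₁ B₂ : Scheme.{0}} (ρ₁ : B₁ ⟶ Spec (.of (D₀ k)))
    (hρ₁ : IsBlowup ρ₁ (ofIdealTop ((mbar k).map (Scheme.ΓSpecIso (.of (D₀ k))).inv.hom)))
    (ρ₂ : B₂ ⟶ B₁)
    (hρ₂ : IsBlowup ρ₂ (vanishingIdeal (⟨ρ₁ ⁻¹' {pt k}, (isClosed_pt k).preimage ρ₁.continuous⟩ : Closeds B₁))) :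
    Scheme.IsRegular B₂ := by
  intro z
  obtain ⟨j, φ, hφoi, ⟨w, hw⟩, hφ⟩ := IsBlowup.exists_chart_of_span_range_eq hρ₁ (gbar k) (span_range_gbar k) (ρ₂ z)
  -- the chart as an open `U` of `B₁`, `e : Spec D₀[𝔪̄₀/x̄ⱼ] ≅ U`
  let U : B₁.Opens := φ.opensRange
  have hzU : ρ₂ z ∈ U := ⟨w, hw⟩
  have hrange : Set.range φ = Set.range U.ι := by
    rw [Scheme.Opens.range_ι]; rfl
  let e := IsOpenImmersion.isoOfRangeEq φ U.ι hrange
  have he : e.hom ≫ U.ι = φ := IsOpenImmersion.isoOfRangeEq_hom_fac _ _ _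
  -- the restricted second blow-up, moved to `Spec D₀[𝔪̄₀/x̄ⱼ]`: a blow-up along `√(x̄ⱼ/1)~`
  have hρ₂U : IsBlowup ((ρ₂ ∣_ U) ≫ e.symm.hom)
      (ofIdealTop (((Ideal.span {exc k j}).radical).map (Scheme.ΓSpecIso (.of (Bch k j))).inv.hom)) := by
    have h := (hρ₂.restrict U).comp_iso e.symm
    rw [← Scheme.IdealSheafData.comap_comp, Iso.symm_inv, he, comap_vanishingIdeal_exceptional j hφ] at h
    exact h
  -- the stalk of `B₂` at `z` is the stalk of `ρ₂⁻¹ U` at `⟨z, _⟩`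
  haveI : IsIso ((ρ₂ ⁻¹ᵁ U).ι.stalkMap ⟨z, hzU⟩) := inferInstance
  suffices hst : IsRegularLocalRing ((↑(ρ₂ ⁻¹ᵁ U) : Scheme.{0}).presheaf.stalk ⟨z, hzU⟩) from by
    haveI := hst
    exact IsRegularLocalRing.of_ringEquiv (asIso ((ρ₂ ⁻¹ᵁ U).ι.stalkMap ⟨z, hzU⟩)).commRingCatIsoToRingEquiv.symm
  -- case analysis on the chart
  have hj : j = 2 ∨ (j = 0 ∨ j = 1) := by fin_cases j <;> simp
  rcases hj with rfl | hj01
  · -- `z̄`-chart: the centre is the unit ideal, `ρ₂` is an isomorphism onto the regular `Spec D₀[𝔪̄₀/z̄]`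
    have hI : ofIdealTop (((Ideal.span {exc k 2}).radical).map (Scheme.ΓSpecIso (.of (Bch k 2))).inv.hom) = ⊤ := by
      rw [radical_span_exc_two, Ideal.map_top]
      exact Scheme.IdealSheafData.ext_of_isAffine (by rw [ideal_ofIdealTop_top]; rfl)
    rw [hI] at hρ₂U
    haveI : IsIso ((ρ₂ ∣_ U) ≫ e.symm.hom) := hρ₂U.isIso isEffectiveCartier_top
    haveI : IsRegularRing (Bch k 2) := SpecimenQuartic.isRegularRing_pointChart₂ k h2
    haveI : IsRegularLocalRing ((Spec (CommRingCat.of (Bch k 2))).presheaf.stalk (((ρ₂ ∣_ U) ≫ e.symm.hom) ⟨z, hzU⟩)) :=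
      Scheme.isRegular_Spec (CommRingCat.of (Bch k 2)) _
    exact IsRegularLocalRing.of_ringEquiv
      (R := (Spec (CommRingCat.of (Bch k 2))).presheaf.stalk (((ρ₂ ∣_ U) ≫ e.symm.hom) ⟨z, hzU⟩))
      (asIso (((ρ₂ ∣_ U) ≫ e.symm.hom).stalkMap ⟨z, hzU⟩)).commRingCatIsoToRingEquiv
  · -- `x̄`/`ȳ`-chart: the centre is `(ε ȳ₁, ε ȳ₂)`; the charts at these generators are the regular line-step rings
    obtain ⟨ε, hε⟩ : ∃ ε : DL k ≃+* Bch k j, ε (Ideal.Quotient.mk (Ideal.span {gL k}) (X 1)) = exc k j := by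
      rcases hj01 with rfl | rfl
      · exact ⟨ε₀, hε₀⟩
      · exact ⟨ε₁, hε₁⟩
    rw [radical_span_exc_eq_of_equiv k j ε hε] at hρ₂U
    obtain ⟨i, ψ, hψoi, ⟨w', hw'⟩, -⟩ := IsBlowup.exists_chart_of_span_range_eq hρ₂U
      (fun i : Fin 2 => ε.toRingHom (Ideal.Quotient.mk (Ideal.span {gL k}) (WhitneyCubic.cen k i)))
      (map_cenL_eq_span_range k j ε).symm ⟨z, hzU⟩
    have hreg := isRegularRing_lineChart_map k h2 j ε i
    by_contra hz
    rw [← hw'] at hz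
    exact not_isRegularLocalRing_localization_of_stalk ψ w' hz (hreg.isRegularLocalRing_localization _)

/-- **LOCAL TWO-STEP REGULARITY of the quartic at a singular point** (unconditional: the presentations are
stub-4's point-step equivalences in generator-tracking form). [OURS · L1 W4.5b · SPECIMEN-Q DOWNSTAIRS R1] [cite: StacksProject, Tag 0804] -/
theorem isRegular_twoStep (h2 : IsUnit (2 : k))
    {B₁ B₂ : Scheme.{0}} (ρ₁ : B₁ ⟶ Spec (.of (D₀ k)))
    (hρ₁ : IsBlowup ρ₁ (ofIdealTop ((mbar k).map (Scheme.ΓSpecIso (.of (D₀ k))).inv.hom)))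
    (ρ₂ : B₂ ⟶ B₁)
    (hρ₂ : IsBlowup ρ₂ (vanishingIdeal (⟨ρ₁ ⁻¹' {pt k}, (isClosed_pt k).preimage ρ₁.continuous⟩ : Closeds B₁))) :
    Scheme.IsRegular B₂ := by
  obtain ⟨ε₀, h₀⟩ := exists_pointChart₀_equiv_track k
  obtain ⟨ε₁, h₁⟩ := exists_pointChart₁_equiv_track k
  exact isRegular_twoStep_of_equiv k h2 ε₀ h₀ ε₁ h₁ ρ₁ hρ₁ ρ₂ hρ₂

end SpecimenQuarticTcDelta

end Summit.ResolutionOfSingularities.ResolutionOfSingularities.Cruxes.EquisingularLiftNat.Sections
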